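import Literature.AnabelianGeometry.AbsoluteAnabelian.AbsTopI.SemiAbsoluteChainsHyp
import Literature.AnabelianGeometry.AbsoluteAnabelian.SlimTransport
import Literature.AnabelianGeometry.AbsoluteAnabelian.SubpadicSlimProofs
import Literature.AnabelianGeometry.AbsoluteAnabelian.SubpadicExamples
import Literature.AnabelianGeometry.AbsoluteAnabelian.MLFAbsoluteGaloisGroupInfinite
import Literature.AnabelianGeometry.AbsoluteAnabelian.AbsTopIII.BiAnabelianModelLiftVacuity
import HarnessLib

/-!
# [AbsTopI] Theorem 4.7 (i)/(iii), `𝒟`-hypothesised forms: the universal closures are REFUTED (schema rows)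

PROOF-ONLY companion of `AbsTopI/SemiAbsoluteChainsHyp.lean` (abc-iut cell, block F, FACT-LIST rows
F-0204 `Thm_4_7_i_of`, F-0205 `Thm_4_7_iii_of`, F-2661 `Thm_4_7_i_ofMem`, F-2662 `Thm_4_7_iii_ofMem`;
no `def`, no edit of the statement file).

The four declarations are MODEL-RELATIVE schemata (cell ruling θ, shape (M)): besides the class `𝒟`
they bind a FREE scheme-side interface `S : SchemeChains E C hP hΔ hne` ("the `X̃/X`-chains of one
member with the natural functor of [AbsTopI] Rmk 4.2.1" — `Obj`, `toPiChain`, `ChainIso`, … are DATA; "No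
instance in the tree (FOUNDATIONS row 12)").  Print ([AbsTopI] Thm 4.7 (i) p. 57) asserts the
conclusion for the GENUINE `X̃/X`-chains; as typed, the universal closure over all `S` is false, which
this file records as kernel theorems (R5: such a row is admissible only AT A NAMED INSTANCE, and no
instance is constructible today):

* `exists_hypotheses_not_thm_4_7_i` — ONE explicit model at universe `0` in which every class-level
  hypothesis of all four declarations HOLDS NON-VACUOUSLY and the conclusion `S.Thm_4_7_i` FAILS:
  the one-object class `𝒟` over the sub-`p`-adic field `ℚ_2` (member `X`, `Mem := True`,
  `IsHyperbolicOrbicurve := True`, `chainTerms := ∅`, so `𝒟` is chain-full; scheme-side morphisms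
  `Hom X X :=` the OPEN outer homomorphisms of `Π_X` over `Γ_{ℚ_2}` with `f ↦ [π₁(f)] := id`, so the
  rel-isom-DGC AND the rel-hom-DGC hold BY A PROOF, not vacuously), whose member extension is the split
  extension `1 → G_{ℚ_2} → G_{ℚ_2} × G_{ℚ_2} → G_{ℚ_2} → 1` (`Π` and `Δ ≅ G_{ℚ_2}` slim by [pGC] Lem 15.8
  PROVED in the tree, `IsSubpadicFor.isSlimGroup_absoluteGaloisGroup`, with the cell's
  `AbsTopIII.isSlimGroup_prod` / `isSlimGroup_of_continuousMulEquiv`; `Δ ≠ 1` by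
  `Padic.infinite_absoluteGaloisGroup`), with cuspless cuspidal data, and the EMPTY scheme-chain datum
  `S` (`Obj := PEmpty`): the trivial `Π`-chain `[Π]` has no preimage, so the essential-surjectivity
  clause of `SchemeChains.Thm_4_7_i` fails.
* `not_forall_thm_4_7_i_of`, `not_forall_thm_4_7_iii_of`, `not_forall_thm_4_7_i_ofMem`,
  `not_forall_thm_4_7_iii_ofMem` — the four universal closures (at universe `0`) are false.

HONEST FRAMING: these refute OUR schema typing (a free interface cannot carry a theorem), not
[AbsTopI] Thm 4.7; the rows stay consumable only in instance form, at the étale-`π₁` scheme chains once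
constructed (no consumer in the tree today).  Nothing here bears on [IUTchIII] Cor 3.12.
-/

noncomputable section

open CategoryTheory Topology

namespace Literature.AnabelianGeometry.AbsoluteAnabelian.AbsTopI

open Literature.AlgebraicGeometry.Frobenioids (IsSlimGroup)
open FundamentalExtension AugmentedProfiniteGrp

/-! ### A slimness tool (products: `AbsTopIII.isSlimGroup_prod`, imported) -/

/-- The kernel `1 × H` of the first projection `G × H ↠ G` is isomorphic, as a topological group, to
`H`. [cite: MochizukiAbsTopI2012, §0 p.8] -/
theorem SchemaWitness.nonempty_continuousMulEquiv_ker_fst (G H : Type) [Group G] [TopologicalSpace G]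
    [Group H] [TopologicalSpace H] :
    Nonempty (H ≃ₜ* (MonoidHom.fst G H).ker) :=
  ⟨{ toFun := fun h => ⟨((1 : G), h), by rw [MonoidHom.mem_ker]; rfl⟩
     invFun := fun x => x.1.2
     left_inv := fun _ => rfl
     right_inv := fun x => by
       obtain ⟨⟨g, h⟩, hx⟩ := x
       have hg : g = 1 := by rwa [MonoidHom.mem_ker] at hx
       subst hg
       rfl
     map_mul' := fun h₁ h₂ => Subtype.ext (by simp)
     continuous_toFun := by
       apply Continuous.subtype_mk
       exact continuous_const.prodMk continuous_id
     continuous_invFun := continuous_snd.comp continuous_subtype_val }⟩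

/-! ### The witness: all class-level hypotheses hold, `Thm_4_7_i` fails -/

/-- **One model in which every hypothesis of `Thm_4_7_i_of` / `Thm_4_7_iii_of` / `Thm_4_7_i_ofMem` /
`Thm_4_7_iii_ofMem` holds and the conclusion `S.Thm_4_7_i` fails** (universe `0`): the one-object
class over `ℚ_2` with member extension `G_{ℚ_2} × G_{ℚ_2} ↠ G_{ℚ_2}`, `Mem := True`,
`IsHyperbolicOrbicurve := True`, `chainTerms := ∅` (chain-full), scheme-side morphisms := the open
outer homomorphisms over `Γ_{ℚ_2}` with `[π₁(·)] := id` (rel-isom-DGC and rel-hom-DGC hold), cuspless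
cuspidal data, and the EMPTY scheme-chain datum (`Obj := PEmpty`), for which the trivial `Π`-chain has
no preimage.  Honest label: a junk instance of the free interface `SchemeChains`, not the `X̃/X`-chains
of print. [cite: MochizukiAbsTopI2012, Thm 4.7 (i) p.57] -/
theorem exists_hypotheses_not_thm_4_7_i :
    ∃ (𝒟 : ConstructionDataClass.{0}) (b : 𝒟.Base) (X : (𝒟.datum b).Obj)
      (C : CuspidalData ((𝒟.datum b).ext X)) (hP : IsSlimGroup ((𝒟.datum b).ext X).arith)
      (hΔ : IsSlimGroup ((𝒟.datum b).ext X).geom) (hne : ((𝒟.datum b).ext X).geom ≠ ⊥)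
      (S : SchemeChains ((𝒟.datum b).ext X) C hP hΔ hne),
      𝒟.Mem b X ∧ 𝒟.IsHyperbolicOrbicurve b X ∧ 𝒟.IsChainFull ∧ 𝒟.RelIsomDGC ∧ 𝒟.RelHomDGC ∧
        ¬ S.Thm_4_7_i := by
  haveI : Fact (Nat.Prime 2) := ⟨Nat.prime_two⟩
  -- the base group `Γ = G_{ℚ_2}` and the split extension `Γ × Γ ↠ Γ`
  let Γ : ProfiniteGrp.{0} := absoluteGaloisGrp ℚ_[2]
  have hΓ : IsSlimGroup Γ := IsSubpadicFor.isSlimGroup_absoluteGaloisGroup (AbsTopIII.IsSubpadicFor.padic 2)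
  haveI : Infinite Γ := Padic.infinite_absoluteGaloisGroup (p := 2)
  let A : AugmentedProfiniteGrp Γ :=
    { arith := ProfiniteGrp.of (Γ × Γ)
      aug := ContinuousMonoidHom.fst Γ Γ
      aug_surjective := fun g => ⟨(g, 1), rfl⟩ }
  -- the one-object relative anabelian datum: morphisms := open outer homomorphisms, `[π₁(·)] := id`
  let D : RelativeAnabelianDatum Γ :=
    { Obj := PUnit
      Hom := fun _ _ => {c : AugmentedProfiniteGrp.OuterHom A A // c.IsOpen}
      IsIso := fun f => f.1.IsIso
      IsHyperbolicCurve := fun _ => True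
      primes := Set.univ
      grp := fun _ => A
      outerHom := fun f => f.1 }
  let 𝒟 : ConstructionDataClass.{0} :=
    { Base := PUnit
      fld := fun _ => ℚ_[2]
      instField := fun _ => inferInstance
      instCharZero := fun _ => inferInstance
      datum := fun _ => D
      Mem := fun _ _ => True
      IsHyperbolicOrbicurve := fun _ _ => True
      isHyperbolicOrbicurve_of_isHyperbolicCurve := fun _ _ _ => trivial
      chainTerms := fun _ _ => ∅ }
  -- an isomorphism is open, so every outer isomorphism class is an (open) scheme-side morphism
  have hopen_of_iso : ∀ c : AugmentedProfiniteGrp.OuterHom A A, c.IsIso → c.IsOpen := by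
    intro c hc
    obtain ⟨φ, rfl⟩ := AugmentedProfiniteGrp.OuterHom.mk_surjective c
    rw [AugmentedProfiniteGrp.OuterHom.isIso_mk] at hc
    rw [AugmentedProfiniteGrp.OuterHom.isOpen_mk]
    change IsOpen (Set.range φ.toHom)
    rw [hc.2.range_eq]
    exact isOpen_univ
  have hIsom : 𝒟.RelIsomDGC := by
    intro b X₁ X₂ _ _
    refine ⟨fun f hf => hf, Subtype.val_injective.injOn, fun c hc => ?_⟩
    exact ⟨⟨c, hopen_of_iso c hc⟩, hc, rfl⟩
  have hHom : 𝒟.RelHomDGC := by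
    intro b X₁ X₂ _ _
    refine ⟨fun f _ => f.2, Subtype.val_injective.injOn, fun c hc => ?_⟩
    exact ⟨⟨c, hc⟩, Set.mem_univ _, rfl⟩
  have hfull : 𝒟.IsChainFull := by
    intro b X _ t ht
    exact absurd ht (Set.notMem_empty t)
  -- the member extension `E = (Γ × Γ ↠ Γ)` and its slimness data
  let E : FundamentalExtension.{0} := (𝒟.datum PUnit.unit).ext PUnit.unit
  have hP : IsSlimGroup E.arith := AbsTopIII.isSlimGroup_prod hΓ hΓ
  have hΔ : IsSlimGroup E.geom := by
    obtain ⟨e⟩ := SchemaWitness.nonempty_continuousMulEquiv_ker_fst Γ Γ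
    exact isSlimGroup_of_continuousMulEquiv e hΓ
  have hne : E.geom ≠ ⊥ := by
    obtain ⟨h, hh⟩ := exists_ne (1 : Γ)
    intro hbot
    -- `E.geom` is, by definition, the kernel of the first projection `Γ × Γ → Γ`
    have hker : (MonoidHom.fst Γ Γ).ker = ⊥ := hbot
    have hmem : ((1, h) : Γ × Γ) ∈ (MonoidHom.fst Γ Γ).ker := by
      rw [MonoidHom.mem_ker]
      rfl
    rw [hker, Subgroup.mem_bot, Prod.mk_eq_one] at hmem
    exact hh hmem.2
  -- cuspless cuspidal data and the EMPTY scheme-chain datum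
  let C : CuspidalData E :=
    { Cusp := PEmpty.{1}
      Dcusp := fun x => x.elim
      Icusp := fun x => x.elim
      Icusp_eq := fun x => x.elim
      isClosed_Dcusp := fun x => x.elim
      eq_of_conj := fun x => x.elim }
  let S : SchemeChains E C hP hΔ hne :=
    { Obj := PEmpty.{1}
      toPiChain := fun x => x.elim
      ChainIso := fun x => x.elim
      HasTerminalMor := fun x => x.elim
      HasTerminalIso := fun x => x.elim
      map_iso := fun x => x.elim
      map_terminalMor := fun x => x.elim
      map_terminalIso := fun x => x.elim }
  -- the trivial `Π`-chain `[Π]` has no preimage under the (empty) functor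
  let c₀ : E.PiChain C hP hΔ hne :=
    { len := 0
      term := fun _ => ChainGroup.self hP hΔ hne
      term_zero := rfl
      types := fun j => j.elim0
      isElemOp := fun j => j.elim0 }
  refine ⟨𝒟, PUnit.unit, PUnit.unit, C, hP, hΔ, hne, S, trivial, trivial, hfull, hIsom, hHom, ?_⟩
  rintro ⟨hsurj, -, -⟩
  obtain ⟨x, -⟩ := hsurj c₀
  exact x.elim

/-! ### The four universal closures are false -/

/-- **F-2661 — the universal closure of `Thm_4_7_i_ofMem` is false** (at universe `0`): at the model of
`exists_hypotheses_not_thm_4_7_i` the member, chain-fullness and rel-isom-DGC hypotheses hold and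
`S.Thm_4_7_i` fails.  Refutes the SCHEMA (free `S`), not [AbsTopI] Thm 4.7 (i).
[cite: MochizukiAbsTopI2012, Thm 4.7 (i) p.57] -/
theorem not_forall_thm_4_7_i_ofMem :
    ¬ ∀ (𝒟 : ConstructionDataClass.{0}) (b : 𝒟.Base) (X : (𝒟.datum b).Obj)
        (C : CuspidalData ((𝒟.datum b).ext X)) (hP : IsSlimGroup ((𝒟.datum b).ext X).arith)
        (hΔ : IsSlimGroup ((𝒟.datum b).ext X).geom) (hne : ((𝒟.datum b).ext X).geom ≠ ⊥)
        (S : SchemeChains ((𝒟.datum b).ext X) C hP hΔ hne), Thm_4_7_i_ofMem 𝒟 b X S := by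
  intro h
  obtain ⟨𝒟, b, X, C, hP, hΔ, hne, S, hmem, -, hfull, hIsom, -, hnot⟩ :=
    exists_hypotheses_not_thm_4_7_i
  exact hnot (h 𝒟 b X C hP hΔ hne S hmem hfull hIsom)

/-- **F-2662 — the universal closure of `Thm_4_7_iii_ofMem` is false** (at universe `0`): at the same
model the member, orbicurve, chain-fullness and rel-hom-DGC hypotheses hold and the first conjunct
`S.Thm_4_7_i` of the conclusion fails.  Refutes the SCHEMA, not [AbsTopI] Thm 4.7 (iii).
[cite: MochizukiAbsTopI2012, Thm 4.7 (iii) p.57] -/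
theorem not_forall_thm_4_7_iii_ofMem :
    ¬ ∀ (𝒟 : ConstructionDataClass.{0}) (b : 𝒟.Base) (X : (𝒟.datum b).Obj)
        (C : CuspidalData ((𝒟.datum b).ext X)) (hP : IsSlimGroup ((𝒟.datum b).ext X).arith)
        (hΔ : IsSlimGroup ((𝒟.datum b).ext X).geom) (hne : ((𝒟.datum b).ext X).geom ≠ ⊥)
        (S : SchemeChains ((𝒟.datum b).ext X) C hP hΔ hne), Thm_4_7_iii_ofMem 𝒟 b X S := by
  intro h
  obtain ⟨𝒟, b, X, C, hP, hΔ, hne, S, hmem, horb, hfull, -, hHom, hnot⟩ :=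
    exists_hypotheses_not_thm_4_7_i
  exact hnot (h 𝒟 b X C hP hΔ hne S hmem horb hfull hHom).1

/-- **F-0204 — the universal closure of `Thm_4_7_i_of` is false** (at universe `0`): instantiate the
(unlinked) class at the witness class and `E` at its member's extension.  Refutes the SCHEMA, not
[AbsTopI] Thm 4.7 (i). [cite: MochizukiAbsTopI2012, Thm 4.7 (i) p.57] -/
theorem not_forall_thm_4_7_i_of :
    ¬ ∀ (𝒟 : ConstructionDataClass.{0}) (E : FundamentalExtension.{0}) (C : CuspidalData E)
        (hP : IsSlimGroup E.arith) (hΔ : IsSlimGroup E.geom) (hne : E.geom ≠ ⊥)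
        (S : SchemeChains E C hP hΔ hne), Thm_4_7_i_of 𝒟 S := by
  intro h
  obtain ⟨𝒟, b, X, C, hP, hΔ, hne, S, -, -, hfull, hIsom, -, hnot⟩ :=
    exists_hypotheses_not_thm_4_7_i
  exact hnot (h 𝒟 _ C hP hΔ hne S hfull hIsom)

/-- **F-0205 — the universal closure of `Thm_4_7_iii_of` is false** (at universe `0`).  Refutes the
SCHEMA, not [AbsTopI] Thm 4.7 (iii). [cite: MochizukiAbsTopI2012, Thm 4.7 (iii) p.57] -/
theorem not_forall_thm_4_7_iii_of :
    ¬ ∀ (𝒟 : ConstructionDataClass.{0}) (E : FundamentalExtension.{0}) (C : CuspidalData E)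
        (hP : IsSlimGroup E.arith) (hΔ : IsSlimGroup E.geom) (hne : E.geom ≠ ⊥)
        (S : SchemeChains E C hP hΔ hne), Thm_4_7_iii_of 𝒟 S := by
  intro h
  obtain ⟨𝒟, b, X, C, hP, hΔ, hne, S, -, -, hfull, -, hHom, hnot⟩ :=
    exists_hypotheses_not_thm_4_7_i
  exact hnot (h 𝒟 _ C hP hΔ hne S hfull hHom).1

end Literature.AnabelianGeometry.AbsoluteAnabelian.AbsTopI
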